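import Literature.MathematicalPhysics.QuantumFieldTheory.ConformalBootstrap3D.PointKernelK34L515.Cert

/-!
# K34L515 instance, cell `l6c6` (parts file: groups 1:21,1:28)

Kernel-v3 cell of the point-functional exclusion instance for the lower box `Δσ ∈ [0.515, 0.520]`,
`Δε ∈ [0.6, 0.95)` (certificate `certL515`, module `PointKernelK34L515.Cert`): spin `ℓ = 6`,
`Δ ∈ [15/2, 241/32)` (centre `A`, half-width `2^-6`), Taylor degree `3`, `n_F = 50`, `2` s-piece(s)
covering `s = Δσ ∈ [103/200, 13/25]`.  Group theorems `l6c6_part<i>_<a>_<b> : gPart … = some <literal>` are checked by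
`decide +kernel` (the literals were produced by `#eval` of the same function); the cell numbers `l6c6_num<i> ≥ 0`
likewise; `l6c6_block` is `PKTM.blockPositive_of_cellPass` applied to them. This file holds only group theorems (the cell stated as a literal); the final file of the cell imports it.  Generated by
`gen/mk_v3cell.py` / `gen/drive_v3.py` (typer-g8).  [folklore]
-/

set_option Elab.async false

namespace Literature.MathematicalPhysics.QuantumFieldTheory.ConformalBootstrap3D

namespace PointKernelK34L515

open PointKernel PKTM
open Literature.Analysis.ValidatedNumerics.PolyMP
open Literature.Analysis.ValidatedNumerics.NumericsMP

/-- group model literal [folklore] -/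
def l6c6_g1_21_28 : G3 := ([⟨-893019166295615045964145120690723043599, -893019165333209675787335383617790638954⟩, ⟨1636751502126969595311864722612226938, 1636752226998055980146397027550831154⟩, ⟨-518309246355888202957228925889158104, -518308500607692500682244825214468467⟩, ⟨-3842172178825459006328671541300397637, -3842171527125650863875256345843181652⟩], [⟨4952184179277220695271997186598008700, 4952184184321914639404197758236295350⟩, ⟨-19238246776401386878226233547055137, -19238242885441861387185846975078329⟩, ⟨14937823913869000209357864992815849, 14937827934104203830108584834878650⟩, ⟨17715443890988036928890007869214819, 17715447421591687381116799391810066⟩], [⟨-13493089790558963961284579873371654, -13493089777271512936787822775721107⟩, ⟨25483655544384827727316021072719, 25483665948892875332122493998518⟩, ⟨-55146938767730535673957716383335, -55146927976909613884475805685203⟩, ⟨-43261243549908928015726235279465, -43261234032740599168179684764981⟩])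

/-- group model literal [folklore] -/
def l6c6_g1_28_34 : G3 := ([⟨487358316264431436096892322997632472246, 487358317315251814871673004279226261982⟩, ⟨16262496787302925818942928667877498641, 16262497566051446905475914277727479972⟩, ⟨3087259343499052390018663545101721588, 3087260144337702584306434273317341515⟩, ⟨2038000696232740739964506362327407757, 2038001402306233804359257587879163668⟩], [⟨-2866982218291444795701539541289339007, -2866982212385878680020482456512892811⟩, ⟨-122449544269422078496177029751709853, -122449539800850600248474703835848675⟩, ⟨-23302567211641055775887647180632282, -23302562603163874653744804771836041⟩, ⟨-10070482426037732188406301110715105, -10070478349789053721624863056586717⟩], [⟨8618969057287651489082810526122093, 8618969074124802363211733097055983⟩, ⟨456505417546397755319794423712957, 456505430441578830301269141700438⟩, ⟨72389648470250478981662281301390, 72389661807176759615608434123011⟩, ⟨27573489700763280231549937824490, 27573501534969451828493207853650⟩])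

/-- group `[21, 28)` of piece 1 [folklore] -/
theorem l6c6_part1_21_28 : gPart certL515 (⟨6, ((481 : ℚ) / 64), 6, 3, 50, 6, 64, ⟨3, 0, 5, 97, 0, 0⟩⟩ : TMCell) (pc ps2 1) 21 28 = some l6c6_g1_21_28 := by decide +kernel

/-- group `[28, 34)` of piece 1 [folklore] -/
theorem l6c6_part1_28_34 : gPart certL515 (⟨6, ((481 : ℚ) / 64), 6, 3, 50, 6, 64, ⟨3, 0, 5, 97, 0, 0⟩⟩ : TMCell) (pc ps2 1) 28 34 = some l6c6_g1_28_34 := by decide +kernel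

end PointKernelK34L515

end Literature.MathematicalPhysics.QuantumFieldTheory.ConformalBootstrap3D
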